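import Mathlib
import Literature.NumberTheory.Automorphic.HilbertModularFormQExpansion
import Summits.Langlands.Langlands.Theorems.CapacityClassicalityHilbertIntegralOverconvergentIsCongruenceStubSmulArgModular
import Summits.Langlands.Langlands.Theorems.CapacityClassicalityHilbertIntegralOverconvergentIsCongruenceStubSmulArgFourierCoeff
import Summits.Langlands.Langlands.Theorems.CapacityClassicalityHilbertIntegralOverconvergentIsCongruenceStubFourierCoeffLinear
import Summits.Langlands.Langlands.Theorems.CapacityClassicalityHilbertIntegralOverconvergentIsCongruenceStubModularFormCoeffSupport
import Summits.Langlands.Langlands.Theorems.CapacityClassicalityHilbertIntegralOverconvergentIsCongruenceStubModularFormPeriodic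
import Summits.Langlands.Langlands.Theorems.CapacityClassicalityHilbertIntegralOverconvergentIsCongruenceStubQExpansionInjective
import Summits.Langlands.Langlands.Theorems.CapacityClassicalityHilbertIntegralOverconvergentIsCongruenceStubFiniteQIndexAntidiagonal
import Summits.Langlands.Langlands.Theorems.CapacityClassicalityHilbertIntegralOverconvergentIsCongruenceSeedSupplyPrelim
import Summits.Langlands.Langlands.Theorems.CapacityClassicalityHilbertIntegralOverconvergentIsCongruenceSeedLeadingExponents

/-!
# A seed form from a non-constant form (stub U9 of line Sketch-ideate-r1-k1)

Stub `stub_seed_of_nonconstant` (U9) of section U of line Sketch-ideate-r1-k1 for the crux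
`HilbertIntegralOverconvergentIsCongruence` (stmt-Langlands-8485): from ANY Hilbert modular form
`h ∈ M_w(Γ₁(𝔫))` over a totally real field `F` of degree `≥ 2` (`𝔫 ≠ 0`) with integer Fourier
coefficients on the cone and a non-zero coefficient at some non-zero cone index one manufactures a
SEED FORM `s(z) := h(z) − h(2z)`, `(2z)_σ = σ(2) z_σ`, of level `Γ₁(𝔫·(2))`: `s` is modular,
`a₀(s) = 0`, `s ≢ 0` on `ℍ`, and `s` has integer coefficients on the cone.

Proof outline.  Write `g := h(2·)`, so `s = h - g`.
* Modularity: `g ∈ M_w(Γ₁(𝔫·(2)))` is the landed `V_δ` stub `stub_smulArg_modular` with `δ = 2`;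
  `h ∈ M_w(Γ₁(𝔫·(2)))` since `Γ₁(𝔫·(2)) ≤ Γ₁(𝔫)` (`𝔫·(2) ≤ 𝔫`, landed `ssp_gamma1_mono`); subtract
  in the submodule.
* Coefficients: the cube integrals are linear on functions continuous on `ℍ`, so
  `a_ν(s) = a_ν(h) - a_ν(g)`, and by the landed `stub_smulArg_fourierCoeff` at a dual-lattice index
  `μ` one has `a_μ(g) = a_{μ/2}(h)` if `μ/2 ∈ 𝔡⁻¹` and `a_μ(g) = 0` otherwise.  At `μ = 0` this gives
  `a₀(s) = a₀(h) - a₀(h) = 0`; at a cone index `ν`, `μ = ν/2` is again a cone index when it lies in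
  `𝔡⁻¹`, so `a_ν(s) = zc ν - zc (ν/2)` or `zc ν` is an integer.
* Non-vanishing: if `s ≡ 0` on `ℍ` then every Fourier coefficient of `s` vanishes (the cube points
  lie in `ℍ`; landed `sle_fourierCoeff_eq_zero_of_eqOn`), so `a_μ(h) = a_μ(g)` for all `μ`.
  Starting from a non-zero cone index `ν` with `a_ν(h) ≠ 0`, induction gives `ν/2ⁿ ∈ 𝔡⁻¹` with
  `a_{ν/2ⁿ}(h) ≠ 0` for every `n` (if `ν/2ⁿ⁺¹ ∉ 𝔡⁻¹` the coefficient `a_{ν/2ⁿ}(h) = a_{ν/2ⁿ}(g)`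
  would vanish).  But the `ν/2ⁿ` are pairwise distinct points of the finite box
  `{μ ∈ 𝔡⁻¹ : 0 ≤ σ μ ≤ σ ν ∀σ}` (landed `fqa_box_finite`) — contradiction.
-/

set_option linter.dupNamespace false

noncomputable section

namespace Summit.Langlands.Langlands.Theorems.HilbertIntegralOverconvergentIsCongruence

open MeasureTheory Complex NumberField
open Literature.NumberTheory.Automorphic Literature.NumberTheory.Automorphic.HilbertModular
open scoped MatrixGroups

/-- Fourier coefficients of a difference of functions continuous on `ℍ` (the cube integrands are
integrable). -/
theorem son_fourierCoeff_sub {F : Type} [Field F] [NumberField F] (f g : Point F → ℂ)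
    (hf : ContinuousOn f (halfSpace F)) (hg : ContinuousOn g (halfSpace F)) (ν : F) :
    fourierCoeff (fun z ↦ f z - g z) ν = fourierCoeff f ν - fourierCoeff g ν := by
  simp only [fourierCoeff_eq, fourierCoeffAt, sub_mul]
  exact integral_sub (fcl_integrableOn_integrand f hf ν fun _ ↦ one_pos)
    (fcl_integrableOn_integrand g hg ν fun _ ↦ one_pos)

/-- **stub U9 — `stub_seed_of_nonconstant` (a seed from a non-constant form).** For
`h ∈ M_w(Γ₁(𝔫))` over a totally real field of degree `≥ 2` (`𝔫 ≠ 0`) with integer coefficients on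
the cone and some non-zero coefficient at a non-zero cone index, `s(z) := h(z) - h(2z)` is a seed
form of level `Γ₁(𝔫·(2))`: modular (`stub_smulArg_modular` with `δ = 2` and `Γ₁(𝔫·(2)) ≤ Γ₁(𝔫)`),
`a₀(s) = a₀(h) - a₀(h) = 0` and integer coefficients `a_ν(s) = a_ν(h) - a_{ν/2}(h)` resp. `a_ν(h)`
(`stub_smulArg_fourierCoeff`, linearity of the cube integrals), and `s ≢ 0` on `ℍ`: otherwise
`a_μ(h) = a_μ(h(2·))` for all `μ`, which starting from a non-zero cone index `ν` with `a_ν(h) ≠ 0`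
forces `ν/2ⁿ ∈ 𝔡⁻¹` with `a_{ν/2ⁿ}(h) ≠ 0` for all `n` — infinitely many distinct points in the finite
box `{μ ∈ 𝔡⁻¹ : 0 ≤ μ ≤ ν}` (`fqa_box_finite`). [folklore] -/
theorem stub_seed_of_nonconstant (F : Type) [Field F] [NumberField F] [NumberField.IsTotallyReal F]
    (hd : 1 < Module.finrank ℚ F) (𝔫 : Ideal (𝓞 F)) (h𝔫 : 𝔫 ≠ ⊥) (w : (F →+* ℝ) → ℤ) (h : Point F → ℂ)
    (hh : h ∈ modularForms (Bianchi.Gamma1 𝔫) w) (zc : F → ℤ)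
    (hzc : ∀ ν ∈ qIndexSet F, fourierCoeff h ν = (zc ν : ℂ))
    (hnc : ∃ ν ∈ qIndexSet F, ν ≠ 0 ∧ fourierCoeff h ν ≠ 0) :
    (fun z : Point F ↦ h z - h (fun σ ↦ ((σ ((2 : 𝓞 F) : F) : ℝ) : ℂ) * z σ)) ∈
        modularForms (Bianchi.Gamma1 (𝔫 * Ideal.span {(2 : 𝓞 F)})) w ∧
      fourierCoeff (fun z : Point F ↦ h z - h (fun σ ↦ ((σ ((2 : 𝓞 F) : F) : ℝ) : ℂ) * z σ)) 0 = 0 ∧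
      (∃ z ∈ halfSpace F, (fun z : Point F ↦ h z - h (fun σ ↦ ((σ ((2 : 𝓞 F) : F) : ℝ) : ℂ) * z σ)) z ≠ 0) ∧
      ∃ zs : F → ℤ, ∀ ν ∈ qIndexSet F,
        fourierCoeff (fun z : Point F ↦ h z - h (fun σ ↦ ((σ ((2 : 𝓞 F) : F) : ℝ) : ℂ) * z σ)) ν = (zs ν : ℂ) := by
  classical
  -- notation: `s = h - g` with `g = h(2·)`
  set s : Point F → ℂ := fun z : Point F ↦ h z - h (fun σ ↦ ((σ ((2 : 𝓞 F) : F) : ℝ) : ℂ) * z σ)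
  set g : Point F → ℂ := fun z : Point F ↦ h (fun σ ↦ ((σ ((2 : 𝓞 F) : F) : ℝ) : ℂ) * z σ)
  have hsg : s = fun z ↦ h z - g z := rfl
  have hd2 : ((2 : 𝓞 F) : F) = 2 := map_ofNat (algebraMap (𝓞 F) F) 2
  have h2ne : ((2 : 𝓞 F) : F) ≠ 0 := by
    rw [hd2]
    exact two_ne_zero
  have hδ : ∀ σ : F →+* ℝ, 0 < σ ((2 : 𝓞 F) : F) := fun σ ↦ by
    rw [hd2, map_ofNat]
    exact two_pos
  -- (1) modularity of `s` for `Γ₁(𝔫·(2))`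
  have hg : g ∈ modularForms (Bianchi.Gamma1 (𝔫 * Ideal.span {(2 : 𝓞 F)})) w :=
    stub_smulArg_modular F hd 𝔫 h𝔫 w h hh 2 hδ
  have hh2 : h ∈ modularForms (Bianchi.Gamma1 (𝔫 * Ideal.span {(2 : 𝓞 F)})) w :=
    modularForms_mono (ssp_gamma1_mono Ideal.mul_le_right) w hh
  have hs_mem : s ∈ modularForms (Bianchi.Gamma1 (𝔫 * Ideal.span {(2 : 𝓞 F)})) w := by
    rw [hsg]
    exact Submodule.sub_mem _ hh2 hg
  -- (2) the coefficients of `s`: `a_ν(s) = a_ν(h) - a_ν(g)` and the coefficients of `g = h(2·)`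
  have hhol : IsHolomorphicOn F h := (mem_modularForms_iff.mp hh).holomorphic
  have hper := stub_modularForm_periodic F 𝔫 w h hh
  have hcoef : ∀ ν : F, fourierCoeff s ν = fourierCoeff h ν - fourierCoeff g ν := fun ν ↦ by
    rw [hsg]
    exact son_fourierCoeff_sub h g hhol.continuousOn
      (mem_modularForms_iff.mp hg).holomorphic.continuousOn ν
  have hcg : ∀ μ : F, (∀ a : 𝓞 F, ∃ n : ℤ, Algebra.trace ℚ F (μ * a) = n) →
      ((∀ a : 𝓞 F, ∃ n : ℤ, Algebra.trace ℚ F (μ / ((2 : 𝓞 F) : F) * a) = n) →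
        fourierCoeff g μ = fourierCoeff h (μ / ((2 : 𝓞 F) : F))) ∧
      ((¬ ∀ a : 𝓞 F, ∃ n : ℤ, Algebra.trace ℚ F (μ / ((2 : 𝓞 F) : F) * a) = n) →
        fourierCoeff g μ = 0) := fun μ hμ ↦
    stub_smulArg_fourierCoeff F h hhol hper 2 hδ μ hμ
  -- (2a) `a₀(s) = 0`
  have hD0 : ∀ a : 𝓞 F, ∃ n : ℤ, Algebra.trace ℚ F ((0 : F) * a) = n := fun a ↦ ⟨0, by simp⟩
  have hcusp : fourierCoeff s 0 = 0 := by
    rw [hcoef, sub_eq_zero]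
    have h0 : (0 : F) / ((2 : 𝓞 F) : F) = 0 := zero_div _
    have key := (hcg 0 hD0).1 (by rw [h0]; exact hD0)
    rw [key, h0]
  -- (2b) integer coefficients on the cone
  have hint : ∃ zs : F → ℤ, ∀ ν ∈ qIndexSet F, fourierCoeff s ν = (zs ν : ℂ) := by
    refine ⟨fun ν ↦ zc ν -
      (if ν / ((2 : 𝓞 F) : F) ∈ qIndexSet F then zc (ν / ((2 : 𝓞 F) : F)) else 0), fun ν hν ↦ ?_⟩
    rw [hcoef ν, hzc ν hν]
    by_cases hD : ∀ a : 𝓞 F, ∃ n : ℤ, Algebra.trace ℚ F (ν / ((2 : 𝓞 F) : F) * a) = n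
    · -- `ν/2 ∈ 𝔡⁻¹` is again a cone index
      have hmem : ν / ((2 : 𝓞 F) : F) ∈ qIndexSet F := ssp_div_mem_qIndexSet 2 hδ hν hD
      rw [(hcg ν hν.1).1 hD, hzc _ hmem]
      dsimp only
      rw [if_pos hmem]
      push_cast
      ring
    · have hnmem : ν / ((2 : 𝓞 F) : F) ∉ qIndexSet F := fun hm ↦ hD hm.1
      rw [(hcg ν hν.1).2 hD]
      dsimp only
      rw [if_neg hnmem]
      push_cast
      ring
  -- (3) `s ≢ 0` on `ℍ`
  have hne : ∃ z ∈ halfSpace F, s z ≠ 0 := by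
    by_contra hcon
    push Not at hcon
    -- all Fourier coefficients of `h` and `g` agree
    have hagree : ∀ μ : F, fourierCoeff h μ = fourierCoeff g μ := fun μ ↦ by
      have h0 := sle_fourierCoeff_eq_zero_of_eqOn hcon μ
      rwa [hcoef, sub_eq_zero] at h0
    obtain ⟨ν, hν, hν0, hνc⟩ := hnc
    have hνpos : ∀ σ : F →+* ℝ, 0 < σ ν := hν.2.resolve_left hν0
    -- iterated halving stays in the dual lattice, with non-zero coefficient
    have hiter : ∀ n : ℕ,
        (∀ a : 𝓞 F, ∃ m : ℤ, Algebra.trace ℚ F (ν / ((2 : 𝓞 F) : F) ^ n * a) = m) ∧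
          fourierCoeff h (ν / ((2 : 𝓞 F) : F) ^ n) ≠ 0 := by
      intro n
      induction n with
      | zero =>
        simp only [pow_zero, div_one]
        exact ⟨hν.1, hνc⟩
      | succ n ih =>
        obtain ⟨hDn, hcn⟩ := ih
        have heq : ν / ((2 : 𝓞 F) : F) ^ n / ((2 : 𝓞 F) : F) = ν / ((2 : 𝓞 F) : F) ^ (n + 1) := by
          rw [div_div, pow_succ]
        by_cases hD : ∀ a : 𝓞 F, ∃ m : ℤ,
            Algebra.trace ℚ F (ν / ((2 : 𝓞 F) : F) ^ n / ((2 : 𝓞 F) : F) * a) = m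
        · have h1 := (hcg _ hDn).1 hD
          rw [heq] at hD h1
          refine ⟨hD, ?_⟩
          rw [← h1, ← hagree]
          exact hcn
        · exact absurd ((hagree _).trans ((hcg _ hDn).2 hD)) hcn
    -- the halvings `ν / 2ⁿ` are pairwise distinct points of the finite box `{μ ∈ 𝔡⁻¹ : 0 ≤ μ ≤ ν}`
    refine (fqa_box_finite F ν).not_infinite
      (Set.infinite_of_injective_forall_mem (f := fun n : ℕ ↦ ν / ((2 : 𝓞 F) : F) ^ n)
        (fun m n hmn ↦ ?_) fun n ↦ ⟨(hiter n).1, fun σ ↦ ?_⟩)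
    · -- injectivity of `n ↦ ν / 2ⁿ`
      have hmn' : ν / ((2 : 𝓞 F) : F) ^ m = ν / ((2 : 𝓞 F) : F) ^ n := hmn
      rw [div_eq_div_iff (pow_ne_zero _ h2ne) (pow_ne_zero _ h2ne)] at hmn'
      have hpow : ((2 : 𝓞 F) : F) ^ n = ((2 : 𝓞 F) : F) ^ m := mul_left_cancel₀ hν0 hmn'
      rw [hd2] at hpow
      have hnat : ((2 ^ n : ℕ) : F) = ((2 ^ m : ℕ) : F) := by
        push_cast
        exact hpow
      exact (Nat.pow_right_injective le_rfl (Nat.cast_injective hnat)).symm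
    · -- `0 ≤ σ(ν)/2ⁿ ≤ σ(ν)`
      rw [map_div₀, map_pow, hd2, map_ofNat]
      exact ⟨div_nonneg (hνpos σ).le (pow_nonneg zero_le_two _),
        div_le_self (hνpos σ).le (one_le_pow₀ one_le_two)⟩
  exact ⟨hs_mem, hcusp, hne, hint⟩

end Summit.Langlands.Langlands.Theorems.HilbertIntegralOverconvergentIsCongruence
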